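import Mathlib.Analysis.Complex.LocallyUniformLimit
import Mathlib.Analysis.Complex.TaylorSeries
import Mathlib.Analysis.Complex.CauchyIntegral
import Mathlib.Analysis.Normed.Module.MultipliableUniformlyOn
import Mathlib.Analysis.SpecialFunctions.Log.Summable
import Mathlib.Analysis.Calculus.Deriv.Polynomial
import Mathlib.Algebra.Polynomial.Derivative
import Literature.Analysis.TotalPositivity.PolyaFrequencyClosure
import Literature.Analysis.Complex.HadamardGenusZero
import HarnessLib

/-!
# PF Taylor sequences of entire functions of genus zero — reduction to ASWE + Hadamard (proved)

Trunk T-ANALYSIS (Literature/Analysis/TotalPositivity). Node L7 of the decomposition of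
`Literature.NumberTheory.LFunctions.katkova_rh_iff_pf` (Katkova 2006, §1 Thm. C: "Let `f` be an entire function. Then
`f ∈ PF_∞` iff `f ∈ L-P⁺`" — "a simple corollary of Theorem ASWE and (1)"). We prove the named fact
`Literature.Analysis.TotalPositivity.pf_taylor_iff_zeros_of_order_lt_one` (PolyaFrequency.lean; Karlin 1968,
Ch. 8, Thm. 5.3, entire case) from its two printed inputs:

* (⇐, elementary + Hadamard) `isPolyaFrequencySeq_taylor_of_hasProd`: if
  `F(z) = C ∏ₖ (1 + αₖ z)` with `C ≥ 0`, `αₖ ≥ 0`, `Σ αₖ < ∞`, then `(F⁽ⁿ⁾(0)/n!)ₙ` is PF — the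
  partial products have PF coefficients (`isPolyaFrequencySeq_coeff_prod_linear`), converge locally
  uniformly (Mathlib `Summable.hasProdLocallyUniformlyOn_one_add`), hence so do all derivatives
  (`TendstoLocallyUniformlyOn.deriv`), and PF is closed under termwise limits. With
  `Literature.Analysis.Complex.hadamard_genus_zero` [Conway 1978, XI.3.4] this gives the direction "zeros real
  `≤ 0` ⇒ PF" (`isPolyaFrequencySeq_taylor_of_zeros`).
* (⇒, ASWE) `zeros_nonpos_of_aswe`: under `aswe_edrei` [Karlin 1968, Ch. 8 Thm. 5.3], if `(aₙ)`
  is PF with `a₀ > 0` and `Σ aₙ zⁿ` is entire with sum `F`, then every zero of `F` is real `≤ 0`: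
  the representation `Σ aₙ wⁿ = C e^{γw} ∏(1+αᵢw)/∏(1-βᵢw)` on a real interval gives, by the
  identity theorem, `F · Q = C e^{γ·} P` on `ℂ` with `P = ∏(1+αᵢ z)`, `Q = ∏(1-βᵢ z)` entire, and
  `P(z) = 0` forces `z = -1/αᵢ`.
* `pf_taylor_iff_zeros_of_order_lt_one_of : aswe_edrei → hadamard_genus_zero →
  pf_taylor_iff_zeros_of_order_lt_one`.

## References

* S. Karlin, *Total Positivity I*, Stanford UP 1968, Ch. 8, §3 and Thm. 5.3.
* M. Aissen, I. J. Schoenberg, A. M. Whitney, J. Analyse Math. 2 (1952) 93–103; A. Edrei, ibid.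
  104–109.
* O. M. Katkova, CMFT 7 (2007), §1, Thm. ASWE and Thm. C; arXiv:math/0505174.
* J. B. Conway, *Functions of One Complex Variable I*, 2nd ed. 1978, Ch. XI, Thm. 3.4.
-/

noncomputable section

open Filter Complex Polynomial Set Metric
open scoped Topology Nat

namespace Literature.Analysis.TotalPositivity

/-! ### Infinite products `∏ (1 + cₖ z)` as entire functions -/

/-- For `Σ ‖cₖ‖ < ∞`, the partial products `∏_{k<N} (1 + cₖ z)` converge locally uniformly on every
open ball to `∏' (1 + cₖ z)`. [folklore] -/
theorem tendstoLocallyUniformlyOn_prod_one_add {c : ℕ → ℂ} (hc : Summable fun k => ‖c k‖)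
    (R : ℝ) :
    TendstoLocallyUniformlyOn (fun N z => ∏ k ∈ Finset.range N, (1 + c k * z))
      (fun z => ∏' k, (1 + c k * z)) atTop (ball (0 : ℂ) R) := by
  have h := Summable.hasProdLocallyUniformlyOn_one_add (f := fun k z => c k * z) (K := ball (0 : ℂ) R)
    isOpen_ball (hc.mul_right |R|) (Eventually.of_forall fun k z hz => ?_)
    (fun k => (continuous_const.mul continuous_id).continuousOn)
  · exact h.tendstoLocallyUniformlyOn_finsetRange
  · rw [norm_mul]
    refine mul_le_mul_of_nonneg_left ?_ (norm_nonneg _)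
    rw [mem_ball_zero_iff] at hz
    exact hz.le.trans (le_abs_self R)

/-- `z ↦ ∏' (1 + cₖ z)` is entire when `Σ ‖cₖ‖ < ∞`. [folklore] -/
theorem differentiable_tprod_one_add {c : ℕ → ℂ} (hc : Summable fun k => ‖c k‖) :
    Differentiable ℂ fun z => ∏' k, (1 + c k * z) := by
  intro z
  have hR : z ∈ ball (0 : ℂ) (‖z‖ + 1) := by simp
  have hdiff := (tendstoLocallyUniformlyOn_prod_one_add hc (‖z‖ + 1)).differentiableOn
    (Eventually.of_forall fun N => ?_) isOpen_ball
  · exact hdiff.differentiableAt (isOpen_ball.mem_nhds hR)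
  · exact (Differentiable.differentiableOn (by fun_prop))

/-- The pointwise product is the `tprod`. [folklore] -/
theorem hasProd_one_add {c : ℕ → ℂ} (hc : Summable fun k => ‖c k‖) (z : ℂ) :
    HasProd (fun k => 1 + c k * z) (∏' k, (1 + c k * z)) :=
  (multipliable_one_add_of_summable (by simpa [norm_mul] using hc.mul_right ‖z‖)).hasProd

/-- Zeros of `∏' (1 + cₖ z)` come from the factors. [folklore] -/
theorem exists_factor_eq_zero_of_tprod_eq_zero {c : ℕ → ℂ} (hc : Summable fun k => ‖c k‖)
    {z : ℂ} (hz : ∏' k, (1 + c k * z) = 0) : ∃ k, 1 + c k * z = 0 := by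
  by_contra h
  push Not at h
  exact tprod_one_add_ne_zero_of_summable h (by simpa [norm_mul] using hc.mul_right ‖z‖) hz

/-! ### Iterated derivatives of locally uniform limits and of polynomials -/

/-- Iterated derivatives of an entire function are entire. [folklore] -/
theorem differentiable_iteratedDeriv {f : ℂ → ℂ} (hf : Differentiable ℂ f) (n : ℕ) :
    Differentiable ℂ (iteratedDeriv n f) := by
  induction n with
  | zero => simpa using hf
  | succ n ih => rw [iteratedDeriv_succ]; exact ih.deriv

/-- Locally uniform convergence of entire functions on an open set passes to all iterated
derivatives (Weierstrass; iterate Mathlib's `TendstoLocallyUniformlyOn.deriv`). [folklore] -/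
theorem tendstoLocallyUniformlyOn_iteratedDeriv {ι : Type*} {p : Filter ι} [p.NeBot]
    {G : ι → ℂ → ℂ} {g : ℂ → ℂ} {U : Set ℂ} (hU : IsOpen U)
    (hG : ∀ i, Differentiable ℂ (G i)) (h : TendstoLocallyUniformlyOn G g p U) (n : ℕ) :
    TendstoLocallyUniformlyOn (fun i => iteratedDeriv n (G i)) (iteratedDeriv n g) p U := by
  induction n with
  | zero => simpa using h
  | succ n ih =>
    have hd : ∀ᶠ i in p, DifferentiableOn ℂ (iteratedDeriv n (G i)) U :=
      Eventually.of_forall fun i => (differentiable_iteratedDeriv (hG i) n).differentiableOn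
    have := ih.deriv hd hU
    simpa [iteratedDeriv_succ, Function.comp_def] using this

/-- Iterated derivatives of a polynomial function. [folklore] -/
theorem iteratedDeriv_polynomial_eval (q : ℂ[X]) (n : ℕ) :
    iteratedDeriv n (fun z => q.eval z) = fun z => (Polynomial.derivative^[n] q).eval z := by
  induction n generalizing q with
  | zero => simp
  | succ n ih =>
    rw [iteratedDeriv_succ']
    have : deriv (fun z => q.eval z) = fun z => q.derivative.eval z := funext fun z => q.deriv
    rw [this, ih, Function.iterate_succ_apply]

/-- `n`-th Taylor coefficient of a polynomial function at `0`. [folklore] -/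
theorem iteratedDeriv_polynomial_eval_zero (q : ℂ[X]) (n : ℕ) :
    iteratedDeriv n (fun z => q.eval z) 0 = (n ! : ℂ) * q.coeff n := by
  rw [iteratedDeriv_polynomial_eval]
  show (Polynomial.derivative^[n] q).eval 0 = _
  rw [← Polynomial.coeff_zero_eq_eval_zero, Polynomial.coeff_iterate_derivative, zero_add,
    Nat.descFactorial_self, nsmul_eq_mul]

/-! ### ⇐ : products of linear factors have PF Taylor sequences -/

/-- The real polynomial `C ∏_{k<N} (1 + αₖ X)` and its complex evaluation. [folklore] -/
theorem eval_map_prod_linear (C : ℝ) (α : ℕ → ℝ) (N : ℕ) (z : ℂ) :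
    ((Polynomial.C C * ∏ k ∈ Finset.range N, (1 + Polynomial.C (α k) * X)).map
        Complex.ofRealHom).eval z = (C : ℂ) * ∏ k ∈ Finset.range N, (1 + (α k : ℂ) * z) := by
  simp [Polynomial.eval_prod, Polynomial.map_prod]

/-- **PF Taylor sequence of `C ∏ (1 + αₖ z)`.** If `F(z) = C · ∏ₖ (1 + αₖ z)` for all `z`
(unconditional product; `F` is then entire), with `C ≥ 0`, `αₖ ≥ 0`, `Σ αₖ < ∞`, then
`(Re F⁽ⁿ⁾(0)/n!)ₙ` is a Pólya frequency sequence. [Aissen–Schoenberg–Whitney 1952, §1;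
Karlin 1968, Ch. 8, §3] [folklore] -/
theorem isPolyaFrequencySeq_taylor_of_hasProd {F : ℂ → ℂ} {C : ℝ} (hC : 0 ≤ C) {α : ℕ → ℝ}
    (hα : ∀ k, 0 ≤ α k) (hs : Summable α)
    (hprod : ∀ z, HasProd (fun k => 1 + (α k : ℂ) * z) (F z / C))
    (hFC : ∀ z, F z = C * (F z / C)) :
    IsPolyaFrequencySeq fun n => (iteratedDeriv n F 0).re / (n ! : ℝ) := by
  -- the complex coefficients `cₖ = αₖ`
  have hc : Summable fun k => ‖((α k : ℝ) : ℂ)‖ := by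
    simpa [Complex.norm_real, Real.norm_of_nonneg (hα _)] using hs
  -- partial products as functions
  set P : ℕ → ℂ → ℂ := fun N z => (C : ℂ) * ∏ k ∈ Finset.range N, (1 + (α k : ℂ) * z) with hP
  -- `F = C · tprod`
  have hFeq : F = fun z => (C : ℂ) * ∏' k, (1 + (α k : ℂ) * z) := by
    funext z
    rw [hFC z, (hprod z).unique (hasProd_one_add hc z)]
  -- locally uniform convergence `P N → F` on the unit ball
  have hunif : TendstoLocallyUniformlyOn P F atTop (ball (0 : ℂ) 1) := by
    rw [hFeq]
    have h1 := tendstoLocallyUniformlyOn_prod_one_add hc 1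
    have h2 := (uniformContinuous_const_smul (C : ℂ)).comp_tendstoLocallyUniformlyOn h1
      (F := fun N z => ∏ k ∈ Finset.range N, (1 + (α k : ℂ) * z))
    simpa [Function.comp_def, hP] using h2
  -- convergence of Taylor coefficients at `0`
  have hcoef : ∀ n, Tendsto (fun N => (iteratedDeriv n (P N) 0).re / (n ! : ℝ)) atTop
      (𝓝 ((iteratedDeriv n F 0).re / (n ! : ℝ))) := by
    intro n
    have hPd : ∀ N, Differentiable ℂ (P N) := fun N => by simp only [hP]; fun_prop
    have h := (tendstoLocallyUniformlyOn_iteratedDeriv isOpen_ball hPd hunif n).tendsto_at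
      (a := 0) (by simp)
    exact ((Complex.continuous_re.tendsto _).comp h).div_const _
  -- each partial product has PF coefficient sequence
  refine IsPolyaFrequencySeq.of_tendsto (l := atTop) (fun N => ?_) hcoef
  have hPN : P N = fun z => ((Polynomial.C C * ∏ k ∈ Finset.range N,
      (1 + Polynomial.C (α k) * X)).map Complex.ofRealHom).eval z := by
    funext z; rw [eval_map_prod_linear]
  have : (fun n => (iteratedDeriv n (P N) 0).re / (n ! : ℝ)) = fun n =>
      (Polynomial.C C * ∏ k ∈ Finset.range N, (1 + Polynomial.C (α k) * X)).coeff n := by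
    funext n
    rw [hPN, iteratedDeriv_polynomial_eval_zero, Polynomial.coeff_map, ← Complex.ofReal_natCast]
    simp only [Complex.ofRealHom_eq_coe, ← Complex.ofReal_mul, Complex.ofReal_re]
    have : (n ! : ℝ) ≠ 0 := by exact_mod_cast n.factorial_ne_zero
    field_simp
  rw [this]
  exact isPolyaFrequencySeq_coeff_prod_linear hC hα N

/-- **Zeros real `≤ 0` ⇒ PF Taylor sequence** for entire functions of order `< 1` with real
Taylor coefficients and `F(0) > 0`, given Hadamard's factorisation in genus `0`
(`Literature.Analysis.Complex.hadamard_genus_zero`, [Conway 1978, XI.3.4]): `F = F(0) ∏ (1 - z/z_k)` with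
`-1/z_k ≥ 0`. [Karlin 1968, Ch. 8, Thm. 5.3 (⇐); Katkova 2006, §1 Thm. C] [folklore] -/
theorem isPolyaFrequencySeq_taylor_of_zeros (hH : Literature.Analysis.Complex.hadamard_genus_zero) {F : ℂ → ℂ}
    (hF : IsEntireOfOrderLtOne F) (hreal : ∀ n : ℕ, (iteratedDeriv n F 0).im = 0)
    (h0 : 0 < (F 0).re) (hz : ∀ z : ℂ, F z = 0 → z.im = 0 ∧ z.re ≤ 0) :
    IsPolyaFrequencySeq fun n => (iteratedDeriv n F 0).re / (n ! : ℝ) := by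
  obtain ⟨hdiff, ρ, C, hρ, hbound⟩ := hF
  have hF0 : F 0 ≠ 0 := fun h => by rw [h] at h0; simp at h0
  obtain ⟨b, hb, hprod⟩ := hH F ρ C hdiff hρ hbound hF0
  -- every `bₙ` is real and `≤ 0`
  have hbn : ∀ n, (b n).im = 0 ∧ (b n).re ≤ 0 := by
    intro n
    by_cases hn : b n = 0
    · simp [hn]
    · -- `1/bₙ` is a zero of `F`
      have hzero : F (b n)⁻¹ = 0 := by
        have h1 : HasProd (fun k => 1 - b k * (b n)⁻¹) 0 :=
          hasProd_zero_of_exists_eq_zero ⟨n, by simp [mul_inv_cancel₀ hn]⟩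
        have := (hprod (b n)⁻¹).unique h1
        rcases div_eq_zero_iff.1 this with h | h
        · exact h
        · exact absurd h hF0
      obtain ⟨him, hre⟩ := hz _ hzero
      rw [Complex.inv_im, div_eq_zero_iff, neg_eq_zero] at him
      rcases him with him | him
      · refine ⟨him, ?_⟩
        rw [Complex.inv_re] at hre
        have hns : 0 < Complex.normSq (b n) := Complex.normSq_pos.2 hn
        by_contra hpos
        push Not at hpos
        have : 0 < (b n).re / Complex.normSq (b n) := div_pos hpos hns
        linarith
      · exact absurd (Complex.normSq_eq_zero.1 him) hn
  -- `αₙ := -Re bₙ ≥ 0`, `bₙ = -αₙ`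
  set α : ℕ → ℝ := fun n => -(b n).re with hα
  have hαb : ∀ n, b n = -((α n : ℝ) : ℂ) := fun n => by
    apply Complex.ext <;> simp [hα, (hbn n).1]
  have hα0 : ∀ n, 0 ≤ α n := fun n => by simp only [hα]; linarith [(hbn n).2]
  have hαs : Summable α :=
    Summable.of_norm_bounded hb fun n => by
      rw [hα, Real.norm_eq_abs, abs_neg]; exact Complex.abs_re_le_norm _
  -- `F 0` is real: `C₀ := Re F(0) > 0`
  have hF0re : F 0 = ((F 0).re : ℂ) := by
    apply Complex.ext
    · simp
    · simpa using hreal 0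
  refine isPolyaFrequencySeq_taylor_of_hasProd h0.le hα0 hαs (fun z => ?_) (fun z => ?_)
  · have := hprod z
    rw [← hF0re]
    convert this using 2 with k
    rw [hαb k]; ring
  · rw [← hF0re, mul_div_cancel₀ _ hF0]

/-! ### ⇒ : PF Taylor sequence ⇒ zeros real `≤ 0` (ASWE) -/

/-- Real infinite products cast to `ℂ`. [folklore] -/
theorem ofReal_tprod_one_add {a : ℕ → ℝ} (ha : Summable a) (w : ℝ) (σ : ℝ) :
    ((∏' i, (1 + σ * (a i * w)) : ℝ) : ℂ) = ∏' i, (1 + ((σ * a i : ℝ) : ℂ) * (w : ℂ)) := by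
  have hs : Summable fun i => ‖σ * (a i * w)‖ := by
    have := (ha.mul_left σ).mul_right w
    refine this.norm.congr fun i => ?_
    simp [mul_assoc]
  have hm : Multipliable fun i => (1 : ℝ) + σ * (a i * w) := multipliable_one_add_of_summable hs
  have := (hm.hasProd.map Complex.ofRealHom Complex.continuous_ofReal).tprod_eq
  rw [Complex.ofRealHom_eq_coe] at this
  rw [← this]
  congr 1
  funext i
  simp only [Function.comp_apply, Complex.ofRealHom_eq_coe]
  push_cast
  ring

/-- **PF ⇒ zeros real and non-positive**, entire case, from the Aissen–Schoenberg–Whitney–Edrei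
representation (`aswe_edrei`, [Karlin 1968, Ch. 8, Thm. 5.3]): if `(aₙ)` is PF with `a₀ > 0` and
`F(z) = Σ aₙ zⁿ` for all `z ∈ ℂ` with `F` entire, then `F(z) = 0 ⇒ z ∈ (-∞, 0]`.
[Karlin 1968, Ch. 8, Thm. 5.3 (⇒); Katkova 2006, §1 Thm. C] [folklore] -/
theorem zeros_nonpos_of_aswe (hA : aswe_edrei) {a : ℕ → ℝ} (hpf : IsPolyaFrequencySeq a)
    (h0 : 0 < a 0) {F : ℂ → ℂ} (hF : Differentiable ℂ F)
    (hsum : ∀ z : ℂ, HasSum (fun n => (a n : ℂ) * z ^ n) (F z)) :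
    ∀ z : ℂ, F z = 0 → z.im = 0 ∧ z.re ≤ 0 := by
  obtain ⟨C, γ, α, β, hC, hγ, hα, hβ, hαs, hβs, ρ, hρ, hrep⟩ := (hA a h0).1 hpf
  -- the entire functions `P = ∏ (1 + αᵢ z)`, `Q = ∏ (1 - βᵢ z)`, `E = C e^{γ z} P`
  set P : ℂ → ℂ := fun z => ∏' i, (1 + ((1 * α i : ℝ) : ℂ) * z) with hP
  set Q : ℂ → ℂ := fun z => ∏' i, (1 + ((-1 * β i : ℝ) : ℂ) * z) with hQ
  have hαc : Summable fun i => ‖((1 * α i : ℝ) : ℂ)‖ := by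
    simpa [Complex.norm_real, Real.norm_of_nonneg (hα _)] using hαs
  have hβc : Summable fun i => ‖((-1 * β i : ℝ) : ℂ)‖ := by
    simpa [Complex.norm_real, Real.norm_of_nonneg (hβ _)] using hβs
  have hPd : Differentiable ℂ P := differentiable_tprod_one_add hαc
  have hQd : Differentiable ℂ Q := differentiable_tprod_one_add hβc
  -- `Q` is `1` at `0`, hence non-zero on a small real interval
  have hQ0 : Q 0 = 1 := by simp [hQ]
  obtain ⟨δ, hδ, hQne⟩ : ∃ δ > 0, ∀ z : ℂ, ‖z‖ < δ → Q z ≠ 0 := by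
    have hc : ContinuousAt Q 0 := hQd.continuous.continuousAt
    have : ∀ᶠ z in 𝓝 (0 : ℂ), Q z ≠ 0 := hc.eventually_ne (by rw [hQ0]; exact one_ne_zero)
    obtain ⟨δ, hδ, h⟩ := Metric.eventually_nhds_iff.1 this
    exact ⟨δ, hδ, fun z hz => h (by simpa using hz)⟩
  -- on the real interval `|w| < min ρ δ`: `F w · Q w = C e^{γ w} P w`
  have hreal : ∀ w : ℝ, |w| < min ρ δ →
      F w * Q w = (C : ℂ) * Complex.exp ((γ : ℂ) * w) * P w := by
    intro w hw
    have hwρ : |w| < ρ := hw.trans_le (min_le_left _ _)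
    have hwδ : ‖(w : ℂ)‖ < δ := by
      rw [Complex.norm_real, Real.norm_eq_abs]; exact hw.trans_le (min_le_right _ _)
    have h1 := hrep w hwρ
    -- `F w` is the (real) sum
    have h2 := Complex.hasSum_ofReal.2 h1
    have hFw : F w = ((C * Real.exp (γ * w) * (∏' i, (1 + α i * w)) / ∏' i, (1 - β i * w) : ℝ) : ℂ) := by
      refine (hsum w).unique ?_
      convert h2 using 1
      funext n
      push_cast
      ring
    have hPw : P w = ((∏' i, (1 + α i * w) : ℝ) : ℂ) := by
      rw [show P w = ∏' i, (1 + ((1 * α i : ℝ) : ℂ) * (w : ℂ)) from rfl,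
        ← ofReal_tprod_one_add hαs w 1]
      congr 1
      exact tprod_congr fun i => by ring
    have hQw : Q w = ((∏' i, (1 - β i * w) : ℝ) : ℂ) := by
      rw [show Q w = ∏' i, (1 + ((-1 * β i : ℝ) : ℂ) * (w : ℂ)) from rfl,
        ← ofReal_tprod_one_add hβs w (-1)]
      congr 1
      exact tprod_congr fun i => by ring
    have hQw0 : (∏' i, (1 - β i * w) : ℝ) ≠ 0 := by
      intro h
      apply hQne w hwδ
      rw [hQw, h, Complex.ofReal_zero]
    rw [hFw, hQw, hPw]
    set p : ℝ := ∏' i, (1 + α i * w) with hp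
    set q : ℝ := ∏' i, (1 - β i * w) with hq
    have hqC : (q : ℂ) ≠ 0 := by exact_mod_cast hQw0
    push_cast [Complex.ofReal_exp]
    field_simp
  -- identity theorem: `F · Q = C e^{γ ·} P` on `ℂ`
  have hident : (fun z => F z * Q z) = fun z => (C : ℂ) * Complex.exp ((γ : ℂ) * z) * P z := by
    refine AnalyticOnNhd.eq_of_frequently_eq (z₀ := (0 : ℂ))
      (analyticOnNhd_univ_iff_differentiable.2 (hF.mul hQd))
      (analyticOnNhd_univ_iff_differentiable.2 (by fun_prop)) ?_
    -- frequently along the reals near `0`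
    have ht : Tendsto (fun w : ℝ => (w : ℂ)) (𝓝[≠] 0) (𝓝[≠] 0) := by
      refine tendsto_nhdsWithin_of_tendsto_nhds_of_eventually_within _
        ((Complex.continuous_ofReal.tendsto' 0 0 (by simp)).mono_left nhdsWithin_le_nhds) ?_
      filter_upwards [self_mem_nhdsWithin] with w hw
      simpa using hw
    refine ht.frequently ?_
    have hev : ∀ᶠ w : ℝ in 𝓝[≠] 0, F w * Q w = (C : ℂ) * Complex.exp ((γ : ℂ) * w) * P w := by
      have : ∀ᶠ w : ℝ in 𝓝 0, |w| < min ρ δ := by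
        filter_upwards [Metric.ball_mem_nhds (0 : ℝ) (lt_min hρ hδ)] with w hw
        rw [Metric.mem_ball, Real.dist_eq, sub_zero] at hw
        exact hw
      filter_upwards [nhdsWithin_le_nhds this] with w hw using hreal w hw
    exact hev.frequently
  -- conclude on zeros
  intro z hz
  have hE : (C : ℂ) * Complex.exp ((γ : ℂ) * z) * P z = 0 := by
    have := congrFun hident z
    rw [← this, hz, zero_mul]
  have hPz : P z = 0 := by
    rcases mul_eq_zero.1 hE with h | h
    · rcases mul_eq_zero.1 h with h | h
      · exact absurd (Complex.ofReal_eq_zero.1 h) hC.ne'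
      · exact absurd h (Complex.exp_ne_zero _)
    · exact h
  obtain ⟨i, hi⟩ := exists_factor_eq_zero_of_tprod_eq_zero hαc hPz
  -- `1 + αᵢ z = 0` with `αᵢ > 0`: `z = -1/αᵢ`
  have hαi : α i ≠ 0 := by
    intro h0'
    rw [h0'] at hi
    simp at hi
  have hαpos : 0 < α i := lt_of_le_of_ne (hα i) (Ne.symm hαi)
  have hz' : z = -(((α i)⁻¹ : ℝ) : ℂ) := by
    have h1 : ((α i : ℝ) : ℂ) * z = -1 := by
      simp only [one_mul] at hi
      linear_combination hi
    have h2 : ((α i : ℝ) : ℂ) ≠ 0 := by exact_mod_cast hαi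
    push_cast
    field_simp
    linear_combination h1
  rw [hz']
  constructor
  · simp
  · simp only [Complex.neg_re, Complex.ofReal_re, Left.neg_nonpos_iff]
    exact inv_nonneg.2 hαpos.le

/-! ### Assembly -/

/-- **Reduction of `pf_taylor_iff_zeros_of_order_lt_one` to ASWE + Hadamard.** For an entire `F`
of order `< 1` with real Taylor coefficients and `F(0) > 0`: `(F⁽ⁿ⁾(0)/n!)` is PF iff all zeros
of `F` are real `≤ 0` — (⇒) by `aswe_edrei` [Karlin 1968, Ch. 8 Thm. 5.3] and the identity theorem,
(⇐) by `hadamard_genus_zero` [Conway 1978, XI.3.4] and closure of PF under products/limits.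
[Karlin 1968, Ch. 8 Thm. 5.3; Katkova 2006, §1 Thm. C] [folklore] -/
theorem pf_taylor_iff_zeros_of_order_lt_one_of (hA : aswe_edrei)
    (hH : Literature.Analysis.Complex.hadamard_genus_zero) : pf_taylor_iff_zeros_of_order_lt_one := by
  intro F hF hreal h0
  constructor
  · intro hpf
    -- Taylor expansion of the entire `F` at `0`
    have hdiff := hF.1
    have hsum : ∀ z : ℂ, HasSum (fun n => (((iteratedDeriv n F 0).re / (n ! : ℝ) : ℝ) : ℂ) * z ^ n)
        (F z) := by
      intro z
      have h := Complex.hasSum_taylorSeries_of_entire hdiff 0 z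
      simp only [sub_zero, smul_eq_mul] at h
      have hfun : (fun n => (((iteratedDeriv n F 0).re / (n ! : ℝ) : ℝ) : ℂ) * z ^ n) =
          fun n => (n ! : ℂ)⁻¹ * (z ^ n * iteratedDeriv n F 0) := by
        funext n
        have hre : ((iteratedDeriv n F 0).re : ℂ) = iteratedDeriv n F 0 := by
          apply Complex.ext
          · simp
          · simp [hreal n]
        push_cast
        rw [hre]
        field_simp
      rw [hfun]
      exact h
    have ha0 : 0 < (iteratedDeriv 0 F 0).re / ((0 : ℕ) ! : ℝ) := by simpa using h0
    exact zeros_nonpos_of_aswe hA hpf ha0 hdiff hsum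
  · exact isPolyaFrequencySeq_taylor_of_zeros hH hF hreal h0

end Literature.Analysis.TotalPositivity
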